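import Literature.NumberTheory.LFunctions.LandauGeneralizedDirichlet

/-!
# Landau's theorem, exponential form with zeros: the right-most zero of a continued `e^{−F}` is REAL

Topic: `Literature/NumberTheory/LFunctions`; a companion of
`Literature/NumberTheory/LFunctions/LandauGeneralizedDirichlet.lean` (Montgomery–Vaughan, *Multiplicative
Number Theory I*, §1.2 Thm. 1.7 and the notes to §1.2: Landau's theorem for generalized Dirichlet series
`F(s) = ∑ᵢ aᵢ e^{−λᵢ s}` with `aᵢ ≥ 0`), whose `Landau.summable_of_differentiableOn_halfPlane_cexp` treats the
case in which `e^{F}` continues holomorphically to a half-plane.  Here the continued function is allowed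
to VANISH: if `E` is holomorphic on `Re s > η` and `E = e^{−F}` on `Re s > σ₁`, and `E` has a zero `ρ` with
`Re ρ > η`, then (`Landau.exists_real_zero_of_eqOn_cexp_neg`) there is a REAL `β ∈ [Re ρ, σ₁]` with
`E(β) = 0` and `E ≠ 0` on `Re s > β` — the zero of `E` of largest real part is real (it is the abscissa of
convergence of `F` over `[η, ∞)`); equivalently (`Landau.re_le_of_zero_of_eqOn_cexp_neg`) if `E ≠ 0` at every
real `σ > η` then `E ≠ 0` on the whole half-plane `Re s > η`.  This is the positivity law behind «the first
singularity of the logarithm of an Euler product with non-negative coefficients is real» (MV §1.2; used for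
quotients `ζ_P/ζ` of Beurling zeta functions in `Literature/Barriers/RiemannHypothesis/`).

Proof (MV, proof of Thm. 1.7, as in the parent file's exponential form): let `σ_c ≥ η` be the infimum of the
real abscissae of absolute convergence in `[η, ∞)`; by the identity theorem `E = e^{−F} ≠ 0` on `Re s > σ_c`,
so `Re ρ ≤ σ_c`; if `E(σ_c) ≠ 0`, a holomorphic logarithm `g` of `E` on a disc about `σ_c`
(`Landau.exists_differentiableOn_cexp_eq`) satisfies `(−g)' = −E'/E = F'` on the part of the disc right of
`σ_c`, so `−g + κ` continues `F` to the disc and the disc form `Landau.summable_of_differentiableOn_ball` makes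
the series converge left of `σ_c` — contradiction.  All statements are proved (sorry-free).

## References
* H. L. Montgomery, R. C. Vaughan, *Multiplicative Number Theory I. Classical Theory*, Cambridge Studies in
  Advanced Mathematics 97, CUP 2007: §1.2, Thm. 1.7 and its proof (held PDF pp. 25–26), notes to §1.2
  (held PDF pp. 35–36). [MontgomeryVaughan2007]
* E. Landau, *Über einen Satz von Tschebyschef*, Math. Ann. 61 (1905), 527–550.
-/

noncomputable section

open Complex Filter Topology Set

namespace Literature.NumberTheory.LFunctions

namespace Landau

variable {ι : Type*} {a ℓ : ι → ℝ}

/-- **Real-zero dominance (Landau positivity law).** Let `aᵢ ≥ 0`, `λᵢ ≥ 0`,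
`∑ᵢ aᵢ e^{−λᵢ σ₁} < ∞`, `F(s) = ∑ᵢ aᵢ e^{−λᵢ s}`, and let `E` be holomorphic on `Re s > η` with
`E = e^{−F}` on `Re s > σ₁`. If `E(ρ) = 0` for some `ρ` with `Re ρ > η`, then there is a real
`β ∈ [Re ρ, σ₁]` with `E(β) = 0` and `E(s) ≠ 0` for `Re s > β` (the right-most zero of `E` is real).
[cite: MontgomeryVaughan2007, §1.2 Thm. 1.7 (proof)] -/
theorem exists_real_zero_of_eqOn_cexp_neg (ha : ∀ i, 0 ≤ a i) (hℓ : ∀ i, 0 ≤ ℓ i)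
    {σ₁ η : ℝ} (h₁ : Summable fun i ↦ a i * Real.exp (-(ℓ i * σ₁)))
    {E : ℂ → ℂ} (hE : DifferentiableOn ℂ E {s : ℂ | η < s.re})
    (hagree : EqOn E (fun s ↦ Complex.exp (-genDirichlet a ℓ s)) {s : ℂ | σ₁ < s.re})
    {ρ : ℂ} (hρ : η < ρ.re) (hEρ : E ρ = 0) :
    ∃ β : ℝ, ρ.re ≤ β ∧ β ≤ σ₁ ∧ E β = 0 ∧ ∀ s : ℂ, β < s.re → E s ≠ 0 := by
  classical
  -- `Re ρ ≤ σ₁`: to the right of `σ₁`, `E = e^{−F} ≠ 0`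
  have hρσ₁ : ρ.re ≤ σ₁ := by
    by_contra h
    push Not at h
    have h1 : E ρ = Complex.exp (-genDirichlet a ℓ ρ) := hagree (show ρ ∈ {s : ℂ | σ₁ < s.re} from h)
    exact Complex.exp_ne_zero _ (h1.symm.trans hEρ)
  have hησ₁ : η < σ₁ := hρ.trans_le hρσ₁
  -- the set of real abscissae of convergence in `[η, ∞)` and its infimum `σc`
  set T : Set ℝ := {σ' : ℝ | η ≤ σ' ∧ Summable fun i ↦ a i * Real.exp (-(ℓ i * σ'))} with hT
  have hT₁ : σ₁ ∈ T := ⟨hησ₁.le, h₁⟩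
  have hTne : T.Nonempty := ⟨σ₁, hT₁⟩
  have hTbdd : BddBelow T := ⟨η, fun σ' hσ' ↦ hσ'.1⟩
  set σc : ℝ := sInf T with hσc
  have hσc₁ : σc ≤ σ₁ := csInf_le hTbdd hT₁
  have hησc : η ≤ σc := le_csInf hTne fun σ' hσ' ↦ hσ'.1
  have hS : ∀ σ' : ℝ, σc < σ' → Summable fun i ↦ a i * Real.exp (-(ℓ i * σ')) := by
    intro σ' hσ'
    obtain ⟨σ'', hσ''T, hlt⟩ := exists_lt_of_csInf_lt hTne hσ'
    exact summable_exp_of_le ha hℓ hlt.le hσ''T.2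
  -- `F` is holomorphic on `Re s > σc` and `E = e^{−F}` there (identity theorem)
  set F : ℂ → ℂ := genDirichlet a ℓ with hFdef
  have hF : DifferentiableOn ℂ F {s : ℂ | σc < s.re} :=
    differentiableOn_genDirichlet_of_forall ha hℓ hS
  have hO : IsOpen {s : ℂ | σc < s.re} := isOpen_re_gt σc
  have hexpF : DifferentiableOn ℂ (fun s ↦ Complex.exp (-F s)) {s : ℂ | σc < s.re} := hF.neg.cexp
  have hEO : DifferentiableOn ℂ E {s : ℂ | σc < s.re} := hE.mono fun s hs ↦ by
    simp only [Set.mem_setOf_eq] at hs ⊢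
    linarith
  have hq : (((σ₁ + 1 : ℝ) : ℂ)) ∈ {s : ℂ | σc < s.re} := by
    simp only [Set.mem_setOf_eq, ofReal_re]
    linarith
  have hev : E =ᶠ[𝓝 (((σ₁ + 1 : ℝ) : ℂ))] fun s ↦ Complex.exp (-F s) := by
    filter_upwards [(isOpen_re_gt σ₁).mem_nhds (show ((σ₁ + 1 : ℝ) : ℂ) ∈ {s : ℂ | σ₁ < s.re}
      by simp)] with s hs
    exact hagree hs
  have hEqO : EqOn E (fun s ↦ Complex.exp (-F s)) {s : ℂ | σc < s.re} :=
    (hEO.analyticOnNhd hO).eqOn_of_preconnected_of_eventuallyEq (hexpF.analyticOnNhd hO)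
      (convex_halfSpace_re_gt σc).isPreconnected hq hev
  -- hence `E ≠ 0` on `Re s > σc`, and `Re ρ ≤ σc`
  have hne : ∀ s : ℂ, σc < s.re → E s ≠ 0 := by
    intro s hs
    rw [hEqO (show s ∈ {s : ℂ | σc < s.re} from hs)]
    exact Complex.exp_ne_zero _
  have hρc : ρ.re ≤ σc := by
    by_contra h
    push Not at h
    exact hne ρ h hEρ
  have hησc' : η < σc := hρ.trans_le hρc
  refine ⟨σc, hρc, hσc₁, ?_, hne⟩
  -- `E(σc) = 0`: otherwise `E` has a holomorphic logarithm about `σc`, which continues `F` past `σc`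
  by_contra hE0
  have hEc : ContinuousAt E (σc : ℂ) := by
    refine (hE.differentiableAt ((isOpen_re_gt η).mem_nhds ?_)).continuousAt
    simpa using hησc'
  obtain ⟨ρ₀, hρ₀, hρ₀ne⟩ : ∃ ρ₀ > 0, ∀ z ∈ Metric.ball (σc : ℂ) ρ₀, E z ≠ 0 := by
    have hne' : ∀ᶠ z in 𝓝 (σc : ℂ), E z ≠ 0 := hEc.eventually_ne hE0
    obtain ⟨ρ₀, hρ₀, hb⟩ := Metric.eventually_nhds_iff_ball.1 hne'
    exact ⟨ρ₀, hρ₀, hb⟩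
  set r : ℝ := min ρ₀ (σc - η) with hr
  have hr0 : 0 < r := lt_min hρ₀ (by linarith)
  have hrη : r ≤ σc - η := min_le_right _ _
  have hballη : Metric.ball (σc : ℂ) r ⊆ {s : ℂ | η < s.re} := by
    intro z hz
    have h1 : |(z - σc).re| ≤ ‖z - (σc : ℂ)‖ := abs_re_le_norm _
    have h2 : ‖z - (σc : ℂ)‖ < r := by simpa [dist_eq_norm] using hz
    have h3 : |z.re - σc| < r := by simpa using h1.trans_lt h2
    have := (abs_lt.mp h3).1
    simp only [Set.mem_setOf_eq]
    linarith
  have hEball : DifferentiableOn ℂ E (Metric.ball (σc : ℂ) r) := hE.mono hballη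
  have h0ball : ∀ z ∈ Metric.ball (σc : ℂ) r, E z ≠ 0 := fun z hz ↦
    hρ₀ne z (Metric.ball_subset_ball (min_le_left _ _) hz)
  -- a holomorphic logarithm `g` of `E` on the disc
  obtain ⟨g, hg, hgexp⟩ := exists_differentiableOn_cexp_eq hEball h0ball
  -- on `U = disc ∩ {Re s > σc}`, `F` and `−g` have the same derivative `−E'/E`
  set U : Set ℂ := Metric.ball (σc : ℂ) r ∩ {s : ℂ | σc < s.re} with hU
  have hUo : IsOpen U := Metric.isOpen_ball.inter hO
  have hUpre : IsPreconnected U :=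
    ((convex_ball _ _).inter (convex_halfSpace_re_gt σc)).isPreconnected
  have hFU : DifferentiableOn ℂ F U := hF.mono Set.inter_subset_right
  have hngU : DifferentiableOn ℂ (fun z ↦ -g z) U := (hg.mono Set.inter_subset_left).neg
  have hderivF : ∀ z ∈ U, deriv F z = -(deriv E z / E z) := by
    intro z hz
    have hzO : z ∈ {s : ℂ | σc < s.re} := hz.2
    have hFz : HasDerivAt F (deriv F z) z := (hF.differentiableAt (hO.mem_nhds hzO)).hasDerivAt
    have h1 : HasDerivAt (fun s ↦ Complex.exp (-F s)) (Complex.exp (-F z) * -deriv F z) z :=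
      hFz.neg.cexp
    have h2 : deriv E z = Complex.exp (-F z) * -deriv F z := by
      have hev' : E =ᶠ[𝓝 z] fun s ↦ Complex.exp (-F s) := by
        filter_upwards [hO.mem_nhds hzO] with s hs
        exact hEqO hs
      rw [hev'.deriv_eq, h1.deriv]
    have h3 : E z = Complex.exp (-F z) := hEqO hzO
    rw [h2, h3, mul_neg, neg_div, neg_neg, mul_div_cancel_left₀ _ (Complex.exp_ne_zero _)]
  have hderivng : ∀ z ∈ U, deriv (fun s ↦ -g s) z = -(deriv E z / E z) := by
    intro z hz
    have hzB : z ∈ Metric.ball (σc : ℂ) r := hz.1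
    have hgz : HasDerivAt g (deriv g z) z :=
      (hg.differentiableAt (Metric.isOpen_ball.mem_nhds hzB)).hasDerivAt
    have h1 : HasDerivAt (fun s ↦ Complex.exp (g s)) (Complex.exp (g z) * deriv g z) z := hgz.cexp
    have h2 : deriv E z = Complex.exp (g z) * deriv g z := by
      have hev' : E =ᶠ[𝓝 z] fun s ↦ Complex.exp (g s) := by
        filter_upwards [Metric.isOpen_ball.mem_nhds hzB] with s hs
        exact (hgexp hs).symm
      rw [hev'.deriv_eq, h1.deriv]
    have h3 : E z = Complex.exp (g z) := (hgexp hzB).symm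
    have h4 : deriv (fun s ↦ -g s) z = -deriv g z := deriv.neg
    rw [h4, h2, h3, mul_div_cancel_left₀ _ (Complex.exp_ne_zero _)]
  obtain ⟨κ, hκ⟩ : ∃ κ, U.EqOn F (fun z ↦ -g z + κ) :=
    hUo.exists_eq_add_of_deriv_eq hUpre hFU hngU fun z hz ↦ by
      rw [hderivF z hz, hderivng z hz]
  -- Landau's disc form at `σ₂ = σc + r/4`, radius `3r/4`, with the continuation `−g + κ` of `F`
  set Ψ : ℂ → ℂ := fun z ↦ -g z + κ with hΨ
  have hball_sub : Metric.ball ((σc + r / 4 : ℝ) : ℂ) (3 * r / 4) ⊆ Metric.ball (σc : ℂ) r := by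
    refine Metric.ball_subset_ball' ?_
    rw [dist_eq_norm, ← ofReal_sub, Complex.norm_real, Real.norm_eq_abs,
      show σc + r / 4 - σc = r / 4 by ring, abs_of_pos (by positivity)]
    linarith
  have hΨdiff : DifferentiableOn ℂ Ψ (Metric.ball ((σc + r / 4 : ℝ) : ℂ) (3 * r / 4)) :=
    (hg.mono hball_sub).neg.add (differentiableOn_const κ)
  have hσ₂U : ((σc + r / 4 : ℝ) : ℂ) ∈ U := by
    refine ⟨?_, ?_⟩
    · rw [Metric.mem_ball, dist_eq_norm, ← ofReal_sub, Complex.norm_real, Real.norm_eq_abs,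
        show σc + r / 4 - σc = r / 4 by ring, abs_of_pos (by positivity)]
      linarith
    · simp only [Set.mem_setOf_eq, ofReal_re]
      linarith
  have hagree₂ : Ψ =ᶠ[𝓝 ((σc + r / 4 : ℝ) : ℂ)] genDirichlet a ℓ := by
    filter_upwards [hUo.mem_nhds hσ₂U] with s hs
    exact (hκ hs).symm
  have h₂ : Summable fun i ↦ a i * Real.exp (-(ℓ i * (σc + r / 8))) := hS _ (by linarith)
  have hstep := summable_of_differentiableOn_ball ha hℓ h₂
    (show σc + r / 8 < σc + r / 4 by linarith) hΨdiff hagree₂ (σ := σc - r / 4) (by linarith)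
  -- so `σc − r/4 ∈ T`, contradicting `σc = inf T`
  have hmem : σc - r / 4 ∈ T := ⟨by linarith, hstep⟩
  have := csInf_le hTbdd hmem
  linarith

/-- **Corollary (real-zero-freeness propagates).** Under the same hypotheses, if `E(σ) ≠ 0` for every real
`σ > η` then `E ≠ 0` on the whole half-plane `Re s > η`: no zero off the real axis can be the right-most one.
[cite: MontgomeryVaughan2007, §1.2 Thm. 1.7 (proof)] -/
theorem re_le_of_zero_of_eqOn_cexp_neg (ha : ∀ i, 0 ≤ a i) (hℓ : ∀ i, 0 ≤ ℓ i)
    {σ₁ η : ℝ} (h₁ : Summable fun i ↦ a i * Real.exp (-(ℓ i * σ₁)))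
    {E : ℂ → ℂ} (hE : DifferentiableOn ℂ E {s : ℂ | η < s.re})
    (hagree : EqOn E (fun s ↦ Complex.exp (-genDirichlet a ℓ s)) {s : ℂ | σ₁ < s.re})
    (hreal : ∀ σ : ℝ, η < σ → E σ ≠ 0) {ρ : ℂ} (hρ : η < ρ.re) : E ρ ≠ 0 := by
  intro hEρ
  obtain ⟨β, hρβ, -, hEβ, -⟩ := exists_real_zero_of_eqOn_cexp_neg ha hℓ h₁ hE hagree hρ hEρ
  exact hreal β (hρ.trans_le hρβ) hEβ

end Landau

end Literature.NumberTheory.LFunctions
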